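import Summits.AtomisticToContinuum.BoseEinsteinCondensation.Theorems.BoxCountShadowCoercivityLine
import Summits.AtomisticToContinuum.BoseEinsteinCondensation.Theorems.BoxCountShadowSiblingCoherence
import HarnessLib

/-!
# BoxCountShadowDisplacementSibRing — the sibling ring share, small tools, and the even-`K` variants of MARG_h / NUM_h / LAB_h

Part 1 of 2 of lens-6 g36's `BoxCountShadowDisplacementSib` (file 10 of the DISP dossier, re-issued sha256 29b67f06…), split for the
400-line rule at the §3/§4 boundary by hand-2 g14 (bodies byte-identical).  §1 the sibling ring share (from the truncated density
law DLT_h), §2 small tools, §3 the even-`K` statements `GroundStateHorizon{CellCount,Count,Label}AffinityEven` (tagged `@[conjecture]`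
by lens-6).  §4 (LOC_h ∧ DLT_h ⟹ MARG^e_h) and §5 (the even chain and `bec_of_loc`) are in `BoxCountShadowDisplacementSib`.
No instances, no notation, no sorry.
-/

noncomputable section

open MeasureTheory Filter Set
open scoped ENNReal NNReal BigOperators Topology

namespace Summit.AtomisticToContinuum.BoseEinsteinCondensation.Theorems.BoxCountShadow

open Literature.MathematicalPhysics.QuantumManyBody.BoseGas
open Summit.AtomisticToContinuum.BoseEinsteinCondensation.Theorems.BoxLatticeFSum
open Summit.AtomisticToContinuum.BoseEinsteinCondensation.Theorems.BoxLabelAffinity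
open Summit.AtomisticToContinuum.BoseEinsteinCondensation.Theorems.BoxHorizonAffinity

variable {n : ℕ}

/-! ### §1  The sibling ring share (from the truncated density law) -/

/-- `Σ_B V(σB) ≤ 2 Σ_B V(B)` (indeed `=`, `σ` being a bijection). [folklore] -/
theorem sum_sib_le_two_mul {K : ℕ} (hKe : Even K) (V : SubIdx K → ℝ≥0∞) :
    ∑ B : SubIdx K, V (sib B) ≤ 2 * ∑ B : SubIdx K, V B := by
  rw [sum_comp_sib hKe V, two_mul]; exact le_self_add

/-- **The ring-share defect bound for the SIBLING neighbour** (truncated form): the proof of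
`ringShareDefect_le_trunc` verbatim with the designated neighbour `nb B` replaced by the dyadic sibling `σ B`
(`σ B ≠ B` and `Σ_B V(σB) ≤ 2 Σ_B V(B)` are all it uses of the neighbour map). [folklore] -/
theorem ringShareDefectSib_le_trunc {L : ℝ} {K : ℕ} (hL : 0 < L) (hK : 0 < K) (hKe : Even K)
    {Φ : Config (n + 1) → ℝ}
    (hΦm : Measurable Φ) (hsym : ∀ (σ : Equiv.Perm (Fin (n + 1))) (X : Config (n + 1)), Φ (X ∘ σ) = Φ X)
    (hΦ1 : ∫⁻ Y : Config n, ∫⁻ x, ENNReal.ofReal (Φ (Matrix.vecCons x Y)) ^ 2 = 1) (θ : ℝ≥0∞) :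
    pairWeightOn L K Φ {p | cellPairMass L K Φ p.1 (sib p.1) p.2 < θ * pairWeight L K Φ p} ≤
      2 * θ + 8 * countVarianceTrunc L K Φ + blockWeight K ^ 2 := by
  have hKr : (0 : ℝ) < K := by exact_mod_cast hK
  have hNr : (0 : ℝ) < ((n + 1 : ℕ) : ℝ) := by positivity
  set lam : ℝ := ((n + 1 : ℕ) : ℝ) / (K : ℝ) ^ 3 with hlamdef
  have hlam : 0 < lam := by positivity
  set D : Set (SubIdx K × ℕ) := {p | cellPairMass L K Φ p.1 (sib p.1) p.2 < θ * pairWeight L K Φ p}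
    with hDdef
  set Dc : SubIdx K → Set ℕ := fun B => {j | (B, j) ∈ D} with hDcdef
  set S : SubIdx K → Set (Config (n + 1)) := fun B => {X | countVec (L / (K : ℝ)) K X B ∈ Dc B} with hSdef
  have hS : ∀ B, MeasurableSet (S B) := fun B => measurableSet_countVec_mem (L / (K : ℝ)) K B (Dc B)
  have hΦ2 : Measurable fun X => ENNReal.ofReal (Φ X) ^ 2 := hΦm.ennreal_ofReal.pow_const 2
  have hT : ∀ B, Measurable ((fun m : SubIdx K → ℕ => m B) ∘ countVec (n := n) (L / (K : ℝ)) K) := fun B =>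
    (measurable_pi_apply B).comp (measurable_countVec (L / (K : ℝ)) K)
  have hNm : ∀ B, Measurable fun X : Config (n + 1) => ((countVec (L / (K : ℝ)) K X B : ℕ) : ℝ≥0∞) := fun B =>
    measurable_natCast_ennreal_countVec B
  -- the truncated variance terms
  set V : SubIdx K → ℝ≥0∞ := fun B => ∫⁻ X : Config (n + 1),
    ENNReal.ofReal (min ((((countVec (L / (K : ℝ)) K X B : ℕ) : ℝ) / lam - 1) ^ 2) 1) *
      ENNReal.ofReal (Φ X) ^ 2 with hVdef
  have hCV : countVarianceTrunc L K Φ = ∑ B, blockWeight K ^ 2 * V B := rfl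
  -- Step 1: the defect weight, cell by cell, as tagged fibre integrals
  have h1 : pairWeightOn L K Φ D = ∑ B, blockWeight K ^ 2 *
      ∫⁻ Y in ((fun m : SubIdx K → ℕ => m B) ∘ countVec (L / (K : ℝ)) K) ⁻¹' (Dc B), sliceSq Φ Y := by
    unfold pairWeightOn
    refine Finset.sum_congr rfl fun B _ => ?_
    rw [← tsum_indicator_fibre volume (hT B) (sliceSq Φ) (Dc B), ← ENNReal.tsum_mul_left]
    refine tsum_congr fun j => ?_
    by_cases hj : (B, j) ∈ D
    · have hj' : j ∈ Dc B := hj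
      rw [Set.indicator_of_mem hj, Set.indicator_of_mem hj']
      rfl
    · have hj' : j ∉ Dc B := hj
      rw [Set.indicator_of_notMem hj, Set.indicator_of_notMem hj', mul_zero]
  -- Step 2: on the defect set the designated neighbour's size-biased mass is small
  have h2 : ∀ B, ∫⁻ X, ((countVec (L / (K : ℝ)) K X (sib B) : ℕ) : ℝ≥0∞) *
      (S B).indicator (fun X => ENNReal.ofReal (Φ X) ^ 2) X ≤
        ((n + 1 : ℕ) : ℝ≥0∞) * (θ * blockWeight K ^ 2) := by
    intro B
    have hne : sib B ≠ B := sib_ne hKe B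
    rw [← exchange_cellPairMass hL hK hΦm hsym hne (Dc B),
      ← tsum_indicator_fibre volume (hT B) (blockMass L K Φ (sib B)) (Dc B)]
    gcongr
    have hS1 : ∑' j : ℕ, cellSlice L K Φ B j = 1 := by
      unfold cellSlice
      rw [← lintegral_eq_tsum_fibre volume (hT B) (sliceSq Φ)]
      exact hΦ1
    calc ∑' j, (Dc B).indicator (fun j => ∫⁻ Y in ((fun m : SubIdx K → ℕ => m B) ∘
              countVec (L / (K : ℝ)) K) ⁻¹' {j}, blockMass L K Φ (sib B) Y) j
        ≤ ∑' j, θ * blockWeight K ^ 2 * cellSlice L K Φ B j := by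
          refine ENNReal.tsum_le_tsum fun j => ?_
          by_cases hj : j ∈ Dc B
          · rw [Set.indicator_of_mem hj]
            have hlt : cellPairMass L K Φ B (sib B) j < θ * pairWeight L K Φ (B, j) := hj
            rw [mul_assoc]
            exact hlt.le
          · rw [Set.indicator_of_notMem hj]
            exact bot_le
      _ = θ * blockWeight K ^ 2 := by rw [ENNReal.tsum_mul_left, hS1, mul_one]
  -- the constant: (2/λ) · N · θ · K⁻³ = 2θ
  have hconst : ENNReal.ofReal (2 / lam) * (((n + 1 : ℕ) : ℝ≥0∞) * (θ * blockWeight K ^ 2)) = 2 * θ := by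
    rw [blockWeight_sq hK, ← ENNReal.ofReal_natCast (n + 1)]
    calc ENNReal.ofReal (2 / lam) * (ENNReal.ofReal ((n + 1 : ℕ) : ℝ) * (θ * ENNReal.ofReal (((K : ℝ) ^ 3)⁻¹)))
        = ENNReal.ofReal (2 / lam * ((n + 1 : ℕ) : ℝ) * ((K : ℝ) ^ 3)⁻¹) * θ := by
          rw [ENNReal.ofReal_mul (by positivity), ENNReal.ofReal_mul (by positivity)]; ring
      _ = 2 * θ := by
          have : 2 / lam * ((n + 1 : ℕ) : ℝ) * ((K : ℝ) ^ 3)⁻¹ = 2 := by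
            rw [hlamdef]; field_simp
          rw [this, ENNReal.ofReal_ofNat]
  -- Step 3: Markov + truncated Chebyshev for the full count of the designated neighbour
  have h3 : ∀ B, ∫⁻ X, (S B).indicator (fun X => ENNReal.ofReal (Φ X) ^ 2) X ≤ 2 * θ + 4 * V (sib B) := by
    intro B
    have hmN : Measurable fun X : Config (n + 1) => ((countVec (L / (K : ℝ)) K X (sib B) : ℕ) : ℝ≥0∞) *
        (S B).indicator (fun X => ENNReal.ofReal (Φ X) ^ 2) X := (hNm (sib B)).mul (hΦ2.indicator (hS B))
    have hmA : Measurable fun X : Config (n + 1) => ENNReal.ofReal (2 / lam) *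
        (((countVec (L / (K : ℝ)) K X (sib B) : ℕ) : ℝ≥0∞) *
          (S B).indicator (fun X => ENNReal.ofReal (Φ X) ^ 2) X) := hmN.const_mul _
    have hpt : ∀ X, (S B).indicator (fun X => ENNReal.ofReal (Φ X) ^ 2) X ≤
        ENNReal.ofReal (2 / lam) * (((countVec (L / (K : ℝ)) K X (sib B) : ℕ) : ℝ≥0∞) *
            (S B).indicator (fun X => ENNReal.ofReal (Φ X) ^ 2) X) +
          4 * (ENNReal.ofReal (min ((((countVec (L / (K : ℝ)) K X (sib B) : ℕ) : ℝ) / lam - 1) ^ 2) 1) *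
            ENNReal.ofReal (Φ X) ^ 2) := by
      intro X
      have h := le_markov_add_chebyshev_trunc hlam (countVec (L / (K : ℝ)) K X (sib B))
        (Set.indicator_le_self (S B) (fun X => ENNReal.ofReal (Φ X) ^ 2) X)
      rw [ENNReal.ofReal_mul (by positivity), ENNReal.ofReal_natCast] at h
      simpa only [mul_assoc] using h
    calc ∫⁻ X, (S B).indicator (fun X => ENNReal.ofReal (Φ X) ^ 2) X
        ≤ ∫⁻ X, (ENNReal.ofReal (2 / lam) * (((countVec (L / (K : ℝ)) K X (sib B) : ℕ) : ℝ≥0∞) *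
            (S B).indicator (fun X => ENNReal.ofReal (Φ X) ^ 2) X) +
          4 * (ENNReal.ofReal (min ((((countVec (L / (K : ℝ)) K X (sib B) : ℕ) : ℝ) / lam - 1) ^ 2) 1) *
            ENNReal.ofReal (Φ X) ^ 2)) := lintegral_mono hpt
      _ = ENNReal.ofReal (2 / lam) * (∫⁻ X, ((countVec (L / (K : ℝ)) K X (sib B) : ℕ) : ℝ≥0∞) *
            (S B).indicator (fun X => ENNReal.ofReal (Φ X) ^ 2) X) + 4 * V (sib B) := by
          rw [lintegral_add_left hmA, lintegral_const_mul _ hmN,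
            lintegral_const_mul _ (measurable_varTermTrunc (sib B) lam hΦm)]
      _ ≤ 2 * θ + 4 * V (sib B) := by
          rw [← hconst]
          exact add_le_add (mul_le_mul' le_rfl (h2 B)) le_rfl
  -- Step 4: the tagged correction Σ_B K⁻³ ∫ q_B ≤ K⁻³
  have h4 : ∑ B : SubIdx K, blockWeight K ^ 2 * ∫⁻ Y, blockMass L K Φ B Y ≤ blockWeight K ^ 2 := by
    rw [← Finset.mul_sum, ← lintegral_finsetSum _ fun B _ => measurable_blockMass L K hΦm B]
    calc blockWeight K ^ 2 * ∫⁻ Y, ∑ B, blockMass L K Φ B Y ≤ blockWeight K ^ 2 * ∫⁻ Y, sliceSq Φ Y :=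
          mul_le_mul' le_rfl (lintegral_mono fun Y => sum_blockMass_le_sliceSq hL hK hΦm Y)
      _ = blockWeight K ^ 2 := by
          have : ∫⁻ Y, sliceSq Φ Y = 1 := hΦ1
          rw [this, mul_one]
  -- assemble
  have ha : ∑ B : SubIdx K, blockWeight K ^ 2 * (2 * θ) ≤ 2 * θ := by
    rw [← Finset.sum_mul, sum_blockWeight_sq hK, one_mul]
  have hb : ∑ B : SubIdx K, blockWeight K ^ 2 * (4 * V (sib B)) ≤ 8 * countVarianceTrunc L K Φ :=
    calc ∑ B : SubIdx K, blockWeight K ^ 2 * (4 * V (sib B))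
        = blockWeight K ^ 2 * (4 * ∑ B : SubIdx K, V (sib B)) := by rw [← Finset.mul_sum, ← Finset.mul_sum]
      _ ≤ blockWeight K ^ 2 * (4 * (2 * ∑ B : SubIdx K, V B)) :=
          mul_le_mul' le_rfl (mul_le_mul' le_rfl (sum_sib_le_two_mul hKe V))
      _ = 8 * (blockWeight K ^ 2 * ∑ B : SubIdx K, V B) := by ring
      _ = 8 * countVarianceTrunc L K Φ := by rw [hCV, Finset.mul_sum]
  have hper : ∀ B : SubIdx K, blockWeight K ^ 2 *
      ∫⁻ Y in ((fun m : SubIdx K → ℕ => m B) ∘ countVec (L / (K : ℝ)) K) ⁻¹' (Dc B), sliceSq Φ Y ≤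
        blockWeight K ^ 2 * (2 * θ) + (blockWeight K ^ 2 * (4 * V (sib B)) +
          blockWeight K ^ 2 * ∫⁻ Y, blockMass L K Φ B Y) := by
    intro B
    rw [← mul_add, ← mul_add]
    refine mul_le_mul' le_rfl ?_
    calc ∫⁻ Y in ((fun m : SubIdx K → ℕ => m B) ∘ countVec (L / (K : ℝ)) K) ⁻¹' (Dc B), sliceSq Φ Y
        ≤ (∫⁻ X, (S B).indicator (fun X => ENNReal.ofReal (Φ X) ^ 2) X) + ∫⁻ Y, blockMass L K Φ B Y :=
          cellSlice_le_full hΦm B (Dc B)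
      _ ≤ (2 * θ + 4 * V (sib B)) + ∫⁻ Y, blockMass L K Φ B Y := add_le_add (h3 B) le_rfl
      _ = 2 * θ + (4 * V (sib B) + ∫⁻ Y, blockMass L K Φ B Y) := add_assoc _ _ _
  rw [h1]
  calc ∑ B, blockWeight K ^ 2 *
          ∫⁻ Y in ((fun m : SubIdx K → ℕ => m B) ∘ countVec (L / (K : ℝ)) K) ⁻¹' (Dc B), sliceSq Φ Y
      ≤ ∑ B, (blockWeight K ^ 2 * (2 * θ) + (blockWeight K ^ 2 * (4 * V (sib B)) +
          blockWeight K ^ 2 * ∫⁻ Y, blockMass L K Φ B Y)) := Finset.sum_le_sum fun B _ => hper B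
    _ = ∑ B, blockWeight K ^ 2 * (2 * θ) + (∑ B, blockWeight K ^ 2 * (4 * V (sib B)) +
          ∑ B, blockWeight K ^ 2 * ∫⁻ Y, blockMass L K Φ B Y) := by
        rw [Finset.sum_add_distrib, Finset.sum_add_distrib]
    _ ≤ 2 * θ + (8 * countVarianceTrunc L K Φ + blockWeight K ^ 2) := add_le_add ha (add_le_add hb h4)
    _ = 2 * θ + 8 * countVarianceTrunc L K Φ + blockWeight K ^ 2 := (add_assoc _ _ _).symm

/-! ### §2  Small tools -/

/-- The parent window: if `2K'` blocks lie in the horizon window of constant `A`, then `K'` blocks lie in the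
window of constant `2A`. [folklore] -/
theorem inWindow_coarse {A ρ L : ℝ} {K' : ℕ} (hK' : 0 < K') (h : InWindow A ρ L (2 * K')) :
    InWindow (2 * A) ρ L K' := by
  obtain ⟨h1, h2⟩ := h
  unfold InWindow
  rw [coarse_side (L := L) hK']
  constructor
  · rw [mul_div_assoc]
    exact mul_le_mul_of_nonneg_left h1 (by norm_num)
  · calc 2 * (L / ((2 * K' : ℕ) : ℝ)) ≤ 2 * (2 * A / Real.sqrt ρ) := mul_le_mul_of_nonneg_left h2 (by norm_num)
      _ = 2 * (2 * A) / Real.sqrt ρ := by ring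

/-- `pairWeightOn (D ∪ E) ≤ pairWeightOn (D ∩ Eᶜ) + pairWeightOn E`. [folklore] -/
theorem pairWeightOn_union_le (L : ℝ) (K : ℕ) (Φ : Config (n + 1) → ℝ) (D E : Set (SubIdx K × ℕ)) :
    pairWeightOn L K Φ (D ∪ E) ≤ pairWeightOn L K Φ (D ∩ Eᶜ) + pairWeightOn L K Φ E := by
  unfold pairWeightOn
  rw [← Finset.sum_add_distrib]
  refine Finset.sum_le_sum fun B _ => ?_
  rw [← ENNReal.tsum_add]
  refine ENNReal.tsum_le_tsum fun j => ?_
  by_cases hE : (B, j) ∈ E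
  · rw [Set.indicator_of_mem (show (B, j) ∈ D ∪ E from Or.inr hE), Set.indicator_of_mem hE]
    exact le_add_self
  · by_cases hD : (B, j) ∈ D
    · rw [Set.indicator_of_mem (show (B, j) ∈ D ∪ E from Or.inl hD),
        Set.indicator_of_mem (show (B, j) ∈ D ∩ Eᶜ from ⟨hD, hE⟩)]
      exact le_self_add
    · rw [Set.indicator_of_notMem (show (B, j) ∉ D ∪ E from fun h => h.elim hD hE)]
      exact bot_le

/-! ### §3  The even-`K` variants of MARG_h, NUM_h, LAB_h -/

/-- **MARG^e_h(η)**: `GroundStateHorizonCellCountAffinity η` demanded only at EVEN block numbers `K` of the window.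
PROVED below from LOC_h(η) ∧ DLT_h(η) (`horizonCellCountAffinityEven_of_loc`); open only through LOC_h(η).  Why it might
fail: only if horizon condensation LOC_h(η) fails at the parent window (the number-locked model states violating it are
not condensed at scale `2ℓ`). [cite: LSSY2005, Thm 7.1 (GP-box BEC ⇒ the statement in the GP window)] -/
@[conjecture] def GroundStateHorizonCellCountAffinityEven (η : ℝ≥0) : Prop :=
  ∀ v : ℝ → ℝ≥0∞, IsRepulsiveFiniteRange v → 0 < scatteringLength v →
    ∃ M₀ : ℝ, 0 < M₀ ∧ ∀ M : ℝ, M₀ ≤ M → ∃ c : ℝ, 0 < c ∧ ∃ ρ₀ : ℝ, 0 < ρ₀ ∧ ∀ ρ : ℝ, 0 < ρ → ρ < ρ₀ →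
      ∀ᶠ n : ℕ in atTop,
        (∃ Ψ₀ : Config (n + 1) → ℝ, (∀ X, 0 ≤ Ψ₀ X) ∧
          IsGroundState v (sideLength ρ (n + 1)) (fun X => (Ψ₀ X : ℂ))) →
        ∀ K : ℕ, 0 < K → Even K → InWindow (M * ρ ^ (-(η : ℝ))) ρ (sideLength ρ (n + 1)) K →
          ENNReal.ofReal c ≤
            cellCountAffinity (sideLength ρ (n + 1)) K (groundState v (n + 1) (sideLength ρ (n + 1)))

/-- **NUM^e_h(η)**: `GroundStateHorizonCountAffinity η` demanded only at EVEN block numbers.  Follows from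
MARG^e_h(η) ∧ CSUF_h(η) (`horizonCountAffinityEven_of_cell`).  Why it might fail: as NUM_h — global near-invariance of
the count law under far one-particle transport (ancestor-parity-locked model states). [cite: LSSY2005, Thm 7.1 (GP-box
BEC ⇒ the statement in the GP window)] -/
@[conjecture] def GroundStateHorizonCountAffinityEven (η : ℝ≥0) : Prop :=
  ∀ v : ℝ → ℝ≥0∞, IsRepulsiveFiniteRange v → 0 < scatteringLength v →
    ∃ M₀ : ℝ, 0 < M₀ ∧ ∀ M : ℝ, M₀ ≤ M → ∃ c : ℝ, 0 < c ∧ ∃ ρ₀ : ℝ, 0 < ρ₀ ∧ ∀ ρ : ℝ, 0 < ρ → ρ < ρ₀ →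
      ∀ᶠ n : ℕ in atTop,
        (∃ Ψ₀ : Config (n + 1) → ℝ, (∀ X, 0 ≤ Ψ₀ X) ∧
          IsGroundState v (sideLength ρ (n + 1)) (fun X => (Ψ₀ X : ℂ))) →
        ∀ K : ℕ, 0 < K → Even K → InWindow (M * ρ ^ (-(η : ℝ))) ρ (sideLength ρ (n + 1)) K →
          ENNReal.ofReal c ≤
            countAffinity (sideLength ρ (n + 1)) K (groundState v (n + 1) (sideLength ρ (n + 1)))

/-- **LAB^e_h(η)**: `GroundStateHorizonLabelAffinity η` demanded only at EVEN block numbers; EQUIVALENT to LAB_h(η)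
up to doubling the horizon constant (`horizonLabelAffinity_of_even`, refinement monotonicity).  Why it might fail: as
LAB_h. [cite: LSSY2005, Thm 7.1 (GP-box BEC ⇒ the statement in the GP window)] -/
@[conjecture] def GroundStateHorizonLabelAffinityEven (η : ℝ≥0) : Prop :=
  ∀ v : ℝ → ℝ≥0∞, IsRepulsiveFiniteRange v → 0 < scatteringLength v →
    ∃ c : ℝ, 0 < c ∧ ∃ M : ℝ, 0 < M ∧ ∃ ρ₀ : ℝ, 0 < ρ₀ ∧ ∀ ρ : ℝ, 0 < ρ → ρ < ρ₀ →
      ∀ᶠ n : ℕ in atTop,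
        (∃ Ψ₀ : Config (n + 1) → ℝ, (∀ X, 0 ≤ Ψ₀ X) ∧
          IsGroundState v (sideLength ρ (n + 1)) (fun X => (Ψ₀ X : ℂ))) →
        ∀ K : ℕ, 0 < K → Even K → InWindow (M * ρ ^ (-(η : ℝ))) ρ (sideLength ρ (n + 1)) K →
          ENNReal.ofReal c ≤
            labelAffinity (sideLength ρ (n + 1)) K (groundState v (n + 1) (sideLength ρ (n + 1)))

end Summit.AtomisticToContinuum.BoseEinsteinCondensation.Theorems.BoxCountShadow

end
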